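import Literature.AnabelianGeometry.AbsoluteAnabelian.RelativeGCHomPointDatumInstances
import Literature.AnabelianGeometry.AbsoluteAnabelian.RelativeGrothendieckConjectureSchemaWitnesses
import HarnessLib

/-!
# [Tpcs] Thm. 4.12 (`Tpcs.Thm_4_12`, FACT-LIST F-0261): INSTANCE FORMS at named data

S. Mochizuki, *Topics surrounding the anabelian geometry of hyperbolic curves*, MSRI Publ. **41** (2003)
119–165 [MochizukiTopics2003], Thm. 4.12 p. 44 of the kurims manuscript (`paper:url-b6dd3c96bfbd`): over a
generalized sub-`p`-adic field `K` with `p ∈ Σ`, "the natural map `Isom(X₁, X₂) → Isom_{Γ_K}(Π_{X₁}, Π_{X₂})` …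
is bijective".  Cell abc-iut, block F, seat abc-iut-f-053 (gen 4), KEY row INST59H3.  PROOF-ONLY companion of
`RelativeGrothendieckConjecture.lean` (abc-iut-L4-t13; imported, never edited; no definition, no instance).

THE ROW.  `Tpcs.Thm_4_12 p K D := IsGeneralizedSubpadicFor K p → p ∈ D.primes → D.RelIsomGC` is a PREDICATE on a
relative anabelian datum `D` over `Γ_K` (the interface "`X ↦ Π_X ↠ Γ_K`, `f ↦ [π₁(f)]`"; cell ruling θ, shape
(M)).  abc-iut-F-lit's kernel census (`plan/LF-KERNEL-STATUS.tsv` col. 14) holds ONLY refuters for this row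
(abc-iut-f-105 `Tpcs.not_forall_thm_4_12`, `not_forall_datum_thm_4_12`, `exists_not_thm_4_12`: the junk datum
with `Hom = ∅`), while the positive side exists only inside `∃`-statements (abc-iut-f-106
`pGC.exists_datum_thmA_and_thmA_isom`).  This file states instance forms with conclusion HEAD the row:

* `Tpcs.thm_4_12_pointDatum p K` — the ONE-OBJECT DATUM OVER THE POINT over `Γ_K` (`Π_X := Γ_K ↠ Γ_K` the
  identity, `Hom = {id}` declared an isomorphism and a hyperbolic curve, `Σ := Set.univ`, `f ↦ [id]`), written
  out as the literal over which the tree's `RelativeAnabelianDatum.relIsomGC_pointDatum` (row INST59C) is stated: its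
  `RelIsomGC` holds outright, hence `Thm_4_12 p K D` for every `p`, `K`.  DEGENERATE (`Δ = 1`).
* `Tpcs.thm_4_12_outerHomDatum p K grp hyp primes` — over EVERY family `grp : ι → AugmentedProfiniteGrp Γ_K` of
  augmented profinite groups (e.g. genuinely non-abelian `Δ`), the TAUTOLOGICAL datum in which
  "`Isom_K(X₁, X₂)`" IS DEFINED to be `Isom^{out}_{Γ_K}(Π_{X₁}, Π_{X₂})` (`Hom X Y := OuterHom`, `outerHom := id`,
  `IsIso := OuterHom.IsIso`): `RelIsomGC` is `Set.BijOn id`, so `Thm_4_12` holds for all `p`, `K`, `hyp`, `primes`.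
  TAUTOLOGICAL: the anabelian dictionary holds by fiat; it shows the typed conclusion constrains only the
  comparison map `f ↦ [π₁(f)]` of the datum.
* NON-VACUITY over `K = ℚ`: `Tpcs.relIsomGC_pointDatum_rat_of_thm_4_12` — both antecedents of the row fire at
  the point datum over `Γ_ℚ` (`ℚ` is generalized sub-`p`-adic for every `p`, abc-iut-f-105's
  `Tpcs.isGeneralizedSubpadicFor_rat`; `p ∈ Set.univ`), so the instance yields its conclusion by modus ponens.

HONEST LABEL: DEGENERATE / TAUTOLOGICAL data — statements about OUR typed interface; the INTENDED instance
(`D` = étale fundamental groups of hyperbolic curves over `K`) is Mochizuki's theorem ([Tpcs] Thm 4.12 via [pGC]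
Thm A and Faltings' `p`-adic Hodge theory), not constructible in the tree (abc-iut FOUNDATIONS rows 12/16/25),
where the row stays a NAMED FACT.  Instantiated ≠ endorsed; typed ≠ proved; nothing here bears on the disputed
[IUTchIII] Cor. 3.12; no side taken.
-/

universe u

namespace Literature.AnabelianGeometry.AbsoluteAnabelian

open AugmentedProfiniteGrp

/-! ### F-0261 at the one-object datum over the point -/

/-- **F-0261, INSTANCE FORM at the point datum over `Γ_K`** (one object, `Π_X := Γ_K ↠ Γ_K` the identity,
`Hom = {id}` declared an isomorphism and a hyperbolic curve, `Σ := Set.univ`, `f ↦ [id]`): `Tpcs.Thm_4_12 p K D`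
holds for every prime `p` and every `K` — its conclusion `RelIsomGC` holds outright at this datum
(the tree's `RelativeAnabelianDatum.relIsomGC_pointDatum`: the only outer isomorphism over the point is
`[id]`).  DEGENERATE (`Δ = 1`). [cite: MochizukiTopics2003, Thm 4.12 p.44] -/
theorem Tpcs.thm_4_12_pointDatum (p : ℕ) [Fact p.Prime] (K : Type u) [Field K] [CharZero K] :
    Literature.AnabelianGeometry.AbsoluteAnabelian.Tpcs.Thm_4_12 p K
      ({ Obj := PUnit.{u + 1}
         Hom := fun _ _ => PUnit.{u + 1}
         IsIso := fun _ => True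
         IsHyperbolicCurve := fun _ => True
         primes := Set.univ
         grp := fun _ =>
           { arith := absoluteGaloisGrp K, aug := ContinuousMonoidHom.id (absoluteGaloisGrp K)
             aug_surjective := Function.surjective_id }
         outerHom := fun _ =>
           AugmentedProfiniteGrp.OuterHom.mk ⟨ContinuousMonoidHom.id _, fun _ => rfl⟩ } :
        RelativeAnabelianDatum (absoluteGaloisGrp K)) :=
  fun _ _ => RelativeAnabelianDatum.relIsomGC_pointDatum (absoluteGaloisGrp K)

/-! ### F-0261 at the tautological "isomorphisms := outer isomorphisms" datum -/

/-- **F-0261, INSTANCE FORM at the tautological datum over every family of augmented profinite groups**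
`grp : ι → AugmentedProfiniteGrp Γ_K` (objects `ι`, "`K`-morphisms `X → Y`" := the outer homomorphisms
`Hom^{out}_{Γ_K}(Π_X, Π_Y)` themselves, "isomorphism" := outer isomorphism, comparison map `f ↦ [π₁(f)] := id`,
hyperbolicity predicate `hyp` and prime set `primes` arbitrary): the relative isom-'GC' conclusion is
`Set.BijOn id {c | c.IsIso} {c | c.IsIso}`, so `Tpcs.Thm_4_12 p K D` holds for every `p`, `K`.  TAUTOLOGICAL
(the anabelian dictionary by fiat, over arbitrary — e.g. non-abelian — `Δ`): the typed row constrains only the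
comparison map of the datum. [cite: MochizukiTopics2003, Thm 4.12 p.44] -/
theorem Tpcs.thm_4_12_outerHomDatum (p : ℕ) [Fact p.Prime] (K : Type u) [Field K] [CharZero K]
    {ι : Type u} (grp : ι → AugmentedProfiniteGrp (absoluteGaloisGrp K)) (hyp : ι → Prop)
    (primes : Set ℕ) :
    Literature.AnabelianGeometry.AbsoluteAnabelian.Tpcs.Thm_4_12 p K
      ({ Obj := ι
         Hom := fun X Y => (grp X).OuterHom (grp Y)
         IsIso := fun c => c.IsIso
         IsHyperbolicCurve := hyp
         primes := primes
         grp := grp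
         outerHom := fun c => c } : RelativeAnabelianDatum (absoluteGaloisGrp K)) :=
  fun _ _ _ _ _ _ => Set.bijOn_id _

/-! ### Non-vacuity over `K = ℚ` -/

/-- **Both antecedents of F-0261 fire at the point datum over `Γ_ℚ`**: `ℚ` is generalized sub-`p`-adic for
every prime `p` (abc-iut-f-105 `Tpcs.isGeneralizedSubpadicFor_rat`, from [pGC] Def 15.4 (i) (2) and [Tpcs] Rmk
after Def 4.11, both PROVED in the tree) and `p ∈ Set.univ`; so `Tpcs.thm_4_12_pointDatum p ℚ` yields its
conclusion `RelIsomGC` by modus ponens — the instance is not a vacuous certificate.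
[cite: MochizukiTopics2003, Thm 4.12 p.44] -/
theorem Tpcs.relIsomGC_pointDatum_rat_of_thm_4_12 (p : ℕ) [Fact p.Prime] :
    Literature.AnabelianGeometry.AbsoluteAnabelian.RelativeAnabelianDatum.RelIsomGC
      ({ Obj := PUnit.{1}
         Hom := fun _ _ => PUnit.{1}
         IsIso := fun _ => True
         IsHyperbolicCurve := fun _ => True
         primes := Set.univ
         grp := fun _ =>
           { arith := absoluteGaloisGrp ℚ, aug := ContinuousMonoidHom.id (absoluteGaloisGrp ℚ)
             aug_surjective := Function.surjective_id }
         outerHom := fun _ =>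
           AugmentedProfiniteGrp.OuterHom.mk ⟨ContinuousMonoidHom.id _, fun _ => rfl⟩ } :
        RelativeAnabelianDatum (absoluteGaloisGrp ℚ)) :=
  Tpcs.thm_4_12_pointDatum p ℚ (Tpcs.isGeneralizedSubpadicFor_rat p) (Set.mem_univ p)

end Literature.AnabelianGeometry.AbsoluteAnabelian
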